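import Summits.QuantumFields.BalabanUV.T4Continuum.Support.ShellMeasureGradientPinnedLocalEnd

/-!
# `T4Continuum.ShellMeasureGradientPinnedDecay` — GP-D: THE (P4) LETTER IS PINNED-QUADRATIC BY DECAY — pinned
# `Prop4Hyp` from ONE displayed derivative-kernel decay, linear in the flat size
(cell `pub-balaban`, sub-cell `t4`, spine estimate NE7c (node U5b); NE7c formalisation swarm, crew seat
`b2b-balaban-t4-ne7c-formalise-leaf-06` gen 6 — own-initiative companion to the locality road (rows S69∕S70∕S75 of
`t4/b2b-balaban-t4-ne7c-p1/LEAVES-NE7c-P1.md`; OFFER journal l.17661); imports this lineage's GP f2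
`ShellMeasureGradientPinnedLocalEnd` (p225798; hence GP f1 `ShellMeasureGradientPinnedLocal` p224993, the owner's S69
`ShellMeasurePinnedNorm` p223286, S66 f3c `ShellMeasureDecayKernelTail` p223071 (`dker`), S65 f2a∕f2c
`ShellMeasureMultiGridNorms` (`WSup`) and the Literature scheme file `B11Prop6Scheme` with
`Prop4Hyp`) ONLY; [folklore]; 0 `def`, 0 `def … : Prop`, 0 sorry, 0 citation)

HONEST FRAMING.  Finite four-torus programme, rung (B)+1 only — NOT infinite volume, NOT a mass gap, NOT the Clay
problem, NOT summit progress; (B), `BetaPertHyp`, (B^μ) are not consumed.  NE7c (`T4IndicatorShell.ShellWeightBound`)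
is NOT PRINTED in [Balaban 1983–89] and NOT PROVED; «NE7c ⇐ the named binders» (trigger c3; WALL
`t4/b2b-balaban-t4-ne7c-p1/WALL-NE7c-P1.md` §2b).  Functional-analytic PLUMBING on OUR side (mean-value inequality in
a weighted sup norm over a finite index set); nothing printed is asserted; [Balaban1985Variational] (97)∕(98) and (73),
[Balaban1984PropagatorsI] (46) are LOCATORS for the TYPE of the displayed binder only.  HONEST DEPENDENCY (cell):
continuum YM on T⁴ ⇐ BetaPertH ∧ nine spine estimates (0/9 proved); BetaPertH ⇐ (D1) ∧ (D4) ∧ CAP+tail; G-an2-4 gates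
asym, D1 and NE2/3/4.

THE POINT.  The live-level END of record (S76 `ShellMeasureLandauEndFinal` over S70 f4 `…pinned_rayE`, S69) reads the
scheme's nonlinearity as a binder `hW : Prop4Hyp (W𝒱 V) C₄ a₃` BETWEEN PINNED SPACES `WSup (pinW δ′ ϖ) 1`.  Two
suppliers exist: S75∕S75 f2 `ShellMeasurePinnedProp4(Weighted).prop4Hyp_pinned(_weighted)` from a LOCATED QUADRATIC
MAJORANT (the displayed currency of a LOCAL polynomial action — S77 for OUR (39)-split action), and this lineage's
GP f2 `prop4Hyp_pinned_tail₂_locGrad` from a FINITE-RANGE Hessian (the ∇-free HD-free one-grid letter).  A PSEUDO-LOCAL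
letter — the HD-dressed terms of (80) (row S66: `HD`, `Δ_πHD`, `HD₃`, kernels of (46)∕(73)∕(3.132) TYPE) — is neither
finite-range nor displayed through a quadratic majorant: its displayed form is a DERIVATIVE-KERNEL DECAY (S66 f3c
`dker`, S67 f2 `entry_fderiv_decay_of_sq_bound`).  THIS FILE is the third route, with literally the same conclusion:
* §1 GENERIC **`norm_pin_le_of_kerOpPin_dker_le`** ∕ **`prop4Hyp_pinned_of_kerOpPin_dker_le`**: `D : (Λ → 𝔄) → (Λ′ → 𝔅)`
  differentiable on the flat `ball 0 r`, `D 0 = 0`, with a pinned derivative bound LINEAR IN THE FLAT SIZE,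
  `‖kerOpPin (dker D A) δ′ ϖi ϖo‖ ≤ C·‖A‖` on the ball, `0 ≤ C`, `0 ≤ δ′`, `0 ≤ ϖi` ⟹ `B11Prop6Scheme.Prop4Hyp D_pin C r`,
  `D_pin := toPiL⁻¹ ∘ D ∘ toPiL` (GP f2 §5's argument made generic: mean value on the flat CLOSED ball of radius
  `‖A‖_flat ≤ ‖Y‖_pin`, where the derivative bound is `≤ C‖A‖`; differentiability through S65 f2a's identities).
* §2 THE DECAY INSTANCE **`opNorm_kerOpPin_dker_le_of_entry_decay`** ∕ **`prop4Hyp_pinned_of_entry_decay`**: ONE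
  displayed binder `‖dker D A c b‖ ≤ c₀·‖A‖·e^{−δρ(pos′ c, pos b)}` on the flat ball ((73)∘(46) TYPE, linear in `‖A‖`),
  a one-sided Lipschitz pin profile (`ϖ x ≤ ϖ y + ρ x y`, `ϖ ≥ 0`), `0 ≤ δ′`, reduced-rate sums
  `Σ_b e^{−(δ−δ′)ρ(x, pos b)} ≤ M` (S69 (A) `opNorm_kerOpPin_le`) ⟹ `Prop4Hyp D_pin (c₀·M) r` — VOLUME-FREE.
* §3 CONSISTENCY: GP f2's END `prop4Hyp_pinned_tail₂_locGrad` RE-DERIVED as §1 ∘ GP f2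
  `opNorm_kerOpPin_dker_tail₂_locGrad_le` (an `example`, same constants — no restatement); `prop4Hyp_pinned_add`:
  a finite-range part and a decaying part ADD at the `Prop4Hyp` level (the shape of S65 f2c `Prop4Hyp.add`, between
  the same pinned spaces).  §4 non-vacuity toy.
LOCATED INPUT (displayed, NOT discharged, NOT asserted): the derivative-kernel decay of the letter.  NOT HERE: that
decay for OUR `termsHD` (a further typing over S66 f3a∕f3b's kernels, on GO), the `WMax`-weighted twin (S75 f2's
currency), [dict] (node O).  NOTHING in the countdown moves; NE7c NOT PROVED; spine PROVED 0∕9.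
-/

noncomputable section

open Metric Set Function Filter
open scoped Topology

namespace Summit.QuantumFields.BalabanUV.T4Continuum.ShellMeasureGradientPinnedDecay

open Literature.MathematicalPhysics.QuantumFieldTheory.Balaban1983to89
open B11Prop6Scheme (Prop4Hyp)
open Summit.QuantumFields.BalabanUV.T4Continuum.ShellMeasureMultiGridNorms (WSup)
open Summit.QuantumFields.BalabanUV.T4Continuum.ShellMeasurePinnedNorm
  (pinW pinW_apply kerOpPin opNorm_kerOpPin_le norm_toPiL_le_of_nonneg)
open Summit.QuantumFields.BalabanUV.T4Continuum.ShellMeasureDecayKernelTail (dker dker_apply)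
open Summit.QuantumFields.BalabanUV.T4Continuum.ShellMeasureLocalGradientTail
  (locGrad tail₂ differentiableOn_locGrad differentiableOn_tail₂ analyticOnNhd_sum)
open Summit.QuantumFields.BalabanUV.T4Continuum.ShellMeasureGradientPinnedLocalEnd
  (norm_sub_pin_le_of_kerOpPin_le_convex opNorm_kerOpPin_dker_tail₂_locGrad_le)

variable {Λ Λ' : Type*} [Fintype Λ] [Fintype Λ'] [DecidableEq Λ] {𝔄 𝔅 : Type*} [NormedAddCommGroup 𝔄]
  [NormedSpace ℂ 𝔄] [NormedAddCommGroup 𝔅] [NormedSpace ℂ 𝔅]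

/-! ## §1 Generic: a pinned derivative bound linear in the flat size ⟹ pinned `Prop4Hyp` -/

section Generic

variable (δ' : ℝ) (ϖi : Λ → ℝ) (ϖo : Λ' → ℝ)

/-- **THE SHARP VARIATION BOUND.**  `D` differentiable on the flat `ball 0 r`, `D 0 = 0`, and
`‖kerOpPin (dker D A) δ′ ϖi ϖo‖ ≤ C·‖A‖` for every `A` in the ball (`0 ≤ C`) ⟹ for `A ∈ ball 0 r`:
`‖D A‖_pin ≤ C·‖A‖_flat·‖A‖_pin` (mean value on the flat CLOSED ball of radius `‖A‖`, convex, inside the open ball).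
[folklore] -/
theorem norm_pin_le_of_kerOpPin_dker_le {D : (Λ → 𝔄) → (Λ' → 𝔅)} {r C : ℝ} (hC : 0 ≤ C)
    (hD : DifferentiableOn ℂ D (ball 0 r)) (hD0 : D 0 = 0)
    (hL : ∀ A ∈ ball (0 : Λ → 𝔄) r, ‖kerOpPin (dker D A) δ' ϖi ϖo‖ ≤ C * ‖A‖)
    {A : Λ → 𝔄} (hA : A ∈ ball (0 : Λ → 𝔄) r) :
    ‖((WSup.toPiL (pinW δ' ϖo) 1).symm (D A) : WSup (pinW δ' ϖo) 1 𝔅)‖ ≤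
      C * ‖A‖ * ‖((WSup.toPiL (pinW δ' ϖi) 1).symm A : WSup (pinW δ' ϖi) 1 𝔄)‖ := by
  have hAn : ‖A‖ < r := mem_ball_zero_iff.1 hA
  have hsub : closedBall (0 : Λ → 𝔄) ‖A‖ ⊆ ball 0 r := closedBall_subset_ball hAn
  have h := norm_sub_pin_le_of_kerOpPin_le_convex δ' ϖi ϖo (convex_closedBall (0 : Λ → 𝔄) ‖A‖) (D := D)
    (L := C * ‖A‖)
    (fun A₁ hA₁ => hD.differentiableAt (isOpen_ball.mem_nhds (hsub hA₁)))
    (fun A₁ hA₁ => (hL A₁ (hsub hA₁)).trans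
      (mul_le_mul_of_nonneg_left (mem_closedBall_zero_iff.1 hA₁) hC))
    (mem_closedBall_zero_iff.2 le_rfl) (mem_closedBall_self (norm_nonneg A))
  simpa [hD0] using h

/-- **PINNED `Prop4Hyp` FROM A PINNED DERIVATIVE BOUND LINEAR IN THE FLAT SIZE.**  `D : (Λ → 𝔄) → (Λ′ → 𝔅)`
differentiable on the flat `ball 0 r`, `D 0 = 0`, `‖kerOpPin (dker D A) δ′ ϖi ϖo‖ ≤ C·‖A‖` on the ball, `0 ≤ C`,
`0 ≤ δ′` and a NONNEGATIVE source pin `0 ≤ ϖi` (so that `‖toPiL Y‖ ≤ ‖Y‖`, S69) ⟹ the map read between the pinned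
spaces, `D_pin := toPiL⁻¹ ∘ D ∘ toPiL : WSup (pinW δ′ ϖi) 1 𝔄 → WSup (pinW δ′ ϖo) 1 𝔅`, satisfies
`B11Prop6Scheme.Prop4Hyp D_pin C r` LITERALLY. [folklore] -/
theorem prop4Hyp_pinned_of_kerOpPin_dker_le {D : (Λ → 𝔄) → (Λ' → 𝔅)} {r C : ℝ} (hC : 0 ≤ C) (hδ' : 0 ≤ δ')
    (hϖ0 : ∀ b, 0 ≤ ϖi b) (hD : DifferentiableOn ℂ D (ball 0 r)) (hD0 : D 0 = 0)
    (hL : ∀ A ∈ ball (0 : Λ → 𝔄) r, ‖kerOpPin (dker D A) δ' ϖi ϖo‖ ≤ C * ‖A‖) :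
    Prop4Hyp (fun Y : WSup (pinW δ' ϖi) 1 𝔄 =>
        ((WSup.toPiL (pinW δ' ϖo) 1).symm (D (WSup.toPiL (pinW δ' ϖi) 1 Y)) : WSup (pinW δ' ϖo) 1 𝔅)) C r where
  quad Y hY := by
    have hflat : ‖WSup.toPiL (pinW δ' ϖi) 1 Y‖ ≤ ‖Y‖ := norm_toPiL_le_of_nonneg hδ' hϖ0 Y
    have hA : WSup.toPiL (pinW δ' ϖi) 1 Y ∈ ball (0 : Λ → 𝔄) r := mem_ball_zero_iff.2 (hflat.trans_lt hY)
    have h := norm_pin_le_of_kerOpPin_dker_le δ' ϖi ϖo hC hD hD0 hL hA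
    rw [(WSup.toPiL (pinW δ' ϖi) 1).symm_apply_apply] at h
    calc _ ≤ C * ‖WSup.toPiL (pinW δ' ϖi) 1 Y‖ * ‖Y‖ := h
      _ ≤ C * ‖Y‖ * ‖Y‖ := by gcongr
      _ = C * ‖Y‖ ^ 2 := by ring
  differentiableOn := by
    have hmaps : MapsTo (WSup.toPiL (𝔄 := 𝔄) (pinW δ' ϖi) 1) {Y : WSup (pinW δ' ϖi) 1 𝔄 | ‖Y‖ < r}
        (ball (0 : Λ → 𝔄) r) := fun Y hY =>
      mem_ball_zero_iff.2 ((norm_toPiL_le_of_nonneg hδ' hϖ0 Y).trans_lt hY)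
    exact (WSup.toPiL (𝔄 := 𝔅) (pinW δ' ϖo) 1).symm.differentiable.comp_differentiableOn
      (hD.comp (WSup.toPiL (𝔄 := 𝔄) (pinW δ' ϖi) 1).differentiable.differentiableOn hmaps)

omit [DecidableEq Λ] in
/-- **TWO LETTERS ADD**: a finite-range part (GP f2) and a decaying part (§2) of the same nonlinearity, each with its
pinned `Prop4Hyp` on the same ball, give the pinned `Prop4Hyp` of the sum with the constants added — read between the
same pinned spaces (the shape of S65 f2c `Prop4Hyp.add`, proved here on the nose to keep the import cone at GP f2).
[folklore] -/
theorem prop4Hyp_pinned_add {D₁ D₂ : (Λ → 𝔄) → (Λ' → 𝔅)} {r C₁ C₂ : ℝ}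
    (h₁ : Prop4Hyp (fun Y : WSup (pinW δ' ϖi) 1 𝔄 =>
        ((WSup.toPiL (pinW δ' ϖo) 1).symm (D₁ (WSup.toPiL (pinW δ' ϖi) 1 Y)) : WSup (pinW δ' ϖo) 1 𝔅)) C₁ r)
    (h₂ : Prop4Hyp (fun Y : WSup (pinW δ' ϖi) 1 𝔄 =>
        ((WSup.toPiL (pinW δ' ϖo) 1).symm (D₂ (WSup.toPiL (pinW δ' ϖi) 1 Y)) : WSup (pinW δ' ϖo) 1 𝔅)) C₂ r) :
    Prop4Hyp (fun Y : WSup (pinW δ' ϖi) 1 𝔄 =>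
        ((WSup.toPiL (pinW δ' ϖo) 1).symm ((D₁ + D₂) (WSup.toPiL (pinW δ' ϖi) 1 Y)) : WSup (pinW δ' ϖo) 1 𝔅))
      (C₁ + C₂) r := by
  have e : (fun Y : WSup (pinW δ' ϖi) 1 𝔄 =>
        ((WSup.toPiL (pinW δ' ϖo) 1).symm ((D₁ + D₂) (WSup.toPiL (pinW δ' ϖi) 1 Y)) : WSup (pinW δ' ϖo) 1 𝔅)) =
      (fun Y : WSup (pinW δ' ϖi) 1 𝔄 =>
        ((WSup.toPiL (pinW δ' ϖo) 1).symm (D₁ (WSup.toPiL (pinW δ' ϖi) 1 Y)) : WSup (pinW δ' ϖo) 1 𝔅)) +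
      (fun Y : WSup (pinW δ' ϖi) 1 𝔄 =>
        ((WSup.toPiL (pinW δ' ϖo) 1).symm (D₂ (WSup.toPiL (pinW δ' ϖi) 1 Y)) : WSup (pinW δ' ϖo) 1 𝔅)) := by
    funext Y
    simp only [Pi.add_apply, map_add]
  rw [e]
  exact
    { quad := fun Y hY => by
        calc _ ≤ ‖((WSup.toPiL (pinW δ' ϖo) 1).symm (D₁ (WSup.toPiL (pinW δ' ϖi) 1 Y)) : WSup (pinW δ' ϖo) 1 𝔅)‖ +
              ‖((WSup.toPiL (pinW δ' ϖo) 1).symm (D₂ (WSup.toPiL (pinW δ' ϖi) 1 Y)) : WSup (pinW δ' ϖo) 1 𝔅)‖ :=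
              norm_add_le _ _
          _ ≤ C₁ * ‖Y‖ ^ 2 + C₂ * ‖Y‖ ^ 2 := add_le_add (h₁.quad Y hY) (h₂.quad Y hY)
          _ = (C₁ + C₂) * ‖Y‖ ^ 2 := by ring
      differentiableOn := h₁.differentiableOn.add h₂.differentiableOn }

end Generic

/-! ## §2 The decay instance: ONE displayed derivative-kernel decay, linear in the flat size -/

section Decay

variable {S : Type*} (ρ : S → S → ℝ) (posIn : Λ → S) (posOut : Λ' → S) (ϖ : S → ℝ)

/-- **THE PINNED DERIVATIVE BOUND FROM THE DECAY DISPLAY.**  If `‖dker D A c b‖ ≤ c₀·‖A‖·e^{−δρ(pos′ c, pos b)}` for every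
`c b` ((73)∘(46) TYPE, linear in `‖A‖`; `0 ≤ c₀`), the pin profile is one-sided Lipschitz (`ϖ x ≤ ϖ y + ρ x y`),
`0 ≤ δ′` and the reduced-rate sums obey `Σ_b e^{−(δ−δ′)ρ(x, pos b)} ≤ M` (`0 ≤ M`), then
`‖kerOpPin (dker D A) δ′ (ϖ∘pos) (ϖ∘pos′)‖ ≤ c₀·M·‖A‖` (S69 (A) at `c₀ := c₀‖A‖`). [folklore] -/
theorem opNorm_kerOpPin_dker_le_of_entry_decay {D : (Λ → 𝔄) → (Λ' → 𝔅)} {c₀ δ δ' M : ℝ} (hc₀ : 0 ≤ c₀)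
    (hδ' : 0 ≤ δ') (hM0 : 0 ≤ M) (hϖ : ∀ x y, ϖ x ≤ ϖ y + ρ x y)
    (hM : ∀ x : S, ∑ b, Real.exp (-((δ - δ') * ρ x (posIn b))) ≤ M) {A : Λ → 𝔄}
    (hdec : ∀ c b, ‖dker D A c b‖ ≤ c₀ * ‖A‖ * Real.exp (-(δ * ρ (posOut c) (posIn b)))) :
    ‖kerOpPin (dker D A) δ' (ϖ ∘ posIn) (ϖ ∘ posOut)‖ ≤ c₀ * M * ‖A‖ := by
  have h := opNorm_kerOpPin_le (dker D A) ρ posIn posOut ϖ (c₀ := c₀ * ‖A‖) (by positivity) hδ' hM0 hdec hϖ hM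
  calc _ ≤ c₀ * ‖A‖ * M := h
    _ = c₀ * M * ‖A‖ := by ring

/-- **GP-D — THE (P4) LETTER IS PINNED-QUADRATIC BY DECAY.**  `D : (Λ → 𝔄) → (Λ′ → 𝔅)` differentiable on the flat
`ball 0 r` with `D 0 = 0` and ONE displayed derivative-kernel decay, linear in the flat size:
`‖dker D A c b‖ ≤ c₀·‖A‖·e^{−δρ(pos′ c, pos b)}` for `A ∈ ball 0 r` ((73)∘(46) TYPE — NOT asserted, NOT discharged);
a nonnegative one-sided Lipschitz pin profile `ϖ` (`0 ≤ ϖ`, `ϖ x ≤ ϖ y + ρ x y`), `0 ≤ δ′`, and the reduced-rate sums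
`Σ_b e^{−(δ−δ′)ρ(x, pos b)} ≤ M`.  Then the letter read between S69's pinned spaces,
`Y ↦ toPiL⁻¹ (D (toPiL Y)) : WSup (pinW δ′ (ϖ∘pos)) 1 𝔄 → WSup (pinW δ′ (ϖ∘pos′)) 1 𝔅`, satisfies
`B11Prop6Scheme.Prop4Hyp … (c₀·M) r` LITERALLY — END-II's `hW` in the pinned currency for a PSEUDO-LOCAL letter,
VOLUME-FREE.  Nothing printed is asserted; no estimate of Bałaban's discharged. [folklore] -/
theorem prop4Hyp_pinned_of_entry_decay {D : (Λ → 𝔄) → (Λ' → 𝔅)} {r c₀ δ δ' M : ℝ} (hc₀ : 0 ≤ c₀) (hδ' : 0 ≤ δ')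
    (hM0 : 0 ≤ M) (hϖ0 : ∀ x, 0 ≤ ϖ x) (hϖ : ∀ x y, ϖ x ≤ ϖ y + ρ x y)
    (hM : ∀ x : S, ∑ b, Real.exp (-((δ - δ') * ρ x (posIn b))) ≤ M)
    (hD : DifferentiableOn ℂ D (ball 0 r)) (hD0 : D 0 = 0)
    (hdec : ∀ A ∈ ball (0 : Λ → 𝔄) r, ∀ c b,
      ‖dker D A c b‖ ≤ c₀ * ‖A‖ * Real.exp (-(δ * ρ (posOut c) (posIn b)))) :
    Prop4Hyp (fun Y : WSup (pinW δ' (ϖ ∘ posIn)) 1 𝔄 =>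
        ((WSup.toPiL (pinW δ' (ϖ ∘ posOut)) 1).symm (D (WSup.toPiL (pinW δ' (ϖ ∘ posIn)) 1 Y)) :
          WSup (pinW δ' (ϖ ∘ posOut)) 1 𝔅)) (c₀ * M) r :=
  prop4Hyp_pinned_of_kerOpPin_dker_le δ' (ϖ ∘ posIn) (ϖ ∘ posOut) (by positivity) hδ' (fun b => hϖ0 (posIn b)) hD
    hD0 (fun A hA => opNorm_kerOpPin_dker_le_of_entry_decay ρ posIn posOut ϖ hc₀ hδ' hM0 hϖ hM (hdec A hA))

/-- **THE LIPSCHITZ FORM** (for S70 f2's `hGWp`-type binders, which want a Lipschitz constant on a ball rather than a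
quadratic bound): under the same decay display, for all `A, A′` in the flat `ball 0 s` with `s ≤ r`:
`‖D A − D A′‖_pin ≤ (c₀·M·s)·‖A − A′‖_pin`. [folklore] -/
theorem norm_sub_pin_le_of_entry_decay_linear {D : (Λ → 𝔄) → (Λ' → 𝔅)} {r s c₀ δ δ' M : ℝ} (hc₀ : 0 ≤ c₀)
    (hδ' : 0 ≤ δ') (hM0 : 0 ≤ M) (hsr : s ≤ r) (hϖ : ∀ x y, ϖ x ≤ ϖ y + ρ x y)
    (hM : ∀ x : S, ∑ b, Real.exp (-((δ - δ') * ρ x (posIn b))) ≤ M)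
    (hD : DifferentiableOn ℂ D (ball 0 r))
    (hdec : ∀ A ∈ ball (0 : Λ → 𝔄) r, ∀ c b,
      ‖dker D A c b‖ ≤ c₀ * ‖A‖ * Real.exp (-(δ * ρ (posOut c) (posIn b))))
    {A A' : Λ → 𝔄} (hA : A ∈ ball (0 : Λ → 𝔄) s) (hA' : A' ∈ ball (0 : Λ → 𝔄) s) :
    ‖((WSup.toPiL (pinW δ' (ϖ ∘ posOut)) 1).symm (D A) -
        (WSup.toPiL (pinW δ' (ϖ ∘ posOut)) 1).symm (D A') : WSup (pinW δ' (ϖ ∘ posOut)) 1 𝔅)‖ ≤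
      c₀ * M * s * ‖((WSup.toPiL (pinW δ' (ϖ ∘ posIn)) 1).symm A -
        (WSup.toPiL (pinW δ' (ϖ ∘ posIn)) 1).symm A' : WSup (pinW δ' (ϖ ∘ posIn)) 1 𝔄)‖ := by
  have hsub : ball (0 : Λ → 𝔄) s ⊆ ball 0 r := ball_subset_ball hsr
  refine norm_sub_pin_le_of_kerOpPin_le_convex δ' (ϖ ∘ posIn) (ϖ ∘ posOut) (convex_ball (0 : Λ → 𝔄) s)
    (fun A₁ hA₁ => hD.differentiableAt (isOpen_ball.mem_nhds (hsub hA₁))) (fun A₁ hA₁ => ?_) hA hA'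
  have hA₁s : ‖A₁‖ ≤ s := (mem_ball_zero_iff.1 hA₁).le
  calc _ ≤ c₀ * M * ‖A₁‖ :=
        opNorm_kerOpPin_dker_le_of_entry_decay ρ posIn posOut ϖ hc₀ hδ' hM0 hϖ hM (hdec A₁ (hsub hA₁))
    _ ≤ c₀ * M * s := by gcongr

end Decay

/-! ## §3 Consistency: the finite-range END of GP f2 is §1 fired on GP f2's pinned derivative bound -/

section Consistency

variable {P : Type*} (Pl : Finset P) (φ : P → (Λ → 𝔄) → ℂ) (supp : P → Finset Λ) (ϖ : Λ → ℝ) {R M₀ : ℝ}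

/-- **GP f2's END RE-DERIVED THROUGH §1** (same constants `m·s·(64M₀∕R³)·e^{δ′r₀}`, `R∕4`): the finite-range route and the
decay route are two instances of ONE generic step.  (Kernel consistency check; GP f2's own proof is untouched.)
[folklore] -/
example {m s : ℕ} {δ' r₀ : ℝ} (hR : 0 < R) (hM₀ : 0 ≤ M₀) (hδ' : 0 ≤ δ')
    (hϖ0 : ∀ b, 0 ≤ ϖ b)
    (ha : ∀ p ∈ Pl, AnalyticOnNhd ℂ (φ p) (ball 0 R))
    (hM : ∀ p ∈ Pl, ∀ A ∈ ball (0 : Λ → 𝔄) R, ‖φ p A‖ ≤ M₀)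
    (hloc : ∀ p ∈ Pl, ∀ A : Λ → 𝔄, ∀ b ∉ supp p, ∀ X : 𝔄, φ p (A + Pi.single b X) = φ p A)
    (hm : ∀ b : Λ, (Pl.filter (fun p => b ∈ supp p)).card ≤ m) (hs : ∀ p ∈ Pl, (supp p).card ≤ s)
    (hϖ : ∀ p ∈ Pl, ∀ b ∈ supp p, ∀ c ∈ supp p, ϖ c ≤ ϖ b + r₀) :
    Prop4Hyp
      (fun Y : WSup (pinW δ' ϖ) 1 𝔄 =>
        ((WSup.toPiL (pinW δ' ϖ) 1).symm
          (tail₂ (locGrad (fun A => ∑ p ∈ Pl, φ p A)) (WSup.toPiL (pinW δ' ϖ) 1 Y)) :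
            WSup (pinW δ' ϖ) 1 (𝔄 →L[ℂ] ℂ)))
      (m * s * (64 * M₀ / R ^ 3) * Real.exp (δ' * r₀)) (R / 4) := by
  have hVa : AnalyticOnNhd ℂ (fun A => ∑ p ∈ Pl, φ p A) (ball (0 : Λ → 𝔄) R) := analyticOnNhd_sum Pl φ ha
  have hWd : DifferentiableOn ℂ (tail₂ (locGrad (fun A => ∑ p ∈ Pl, φ p A))) (ball (0 : Λ → 𝔄) (R / 4)) :=
    (differentiableOn_tail₂ (differentiableOn_locGrad hVa)).mono (ball_subset_ball (by linarith))
  exact prop4Hyp_pinned_of_kerOpPin_dker_le δ' ϖ ϖ (by positivity) hδ' hϖ0 hWd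
    (ShellMeasureLocalGradientTail.tail₂_zero _)
    (fun A hA => opNorm_kerOpPin_dker_tail₂_locGrad_le Pl φ supp ϖ hR hM₀ hδ' ha hM hloc hm hs hϖ hA)

end Consistency

/-! ## §4 Non-vacuity -/

section Toy

/-- NON-VACUITY (trigger c3): the binder shapes of `prop4Hyp_pinned_of_entry_decay` are jointly inhabited — the ZERO
letter on one-point index sets (`c₀ = 0`, `M = 1`, `r = 1`, `δ = δ′ = 0`, pin `ϖ ≡ 0`, `ρ ≡ 0`). [folklore] -/
example : Prop4Hyp (fun Y : WSup (pinW (0 : ℝ) ((fun _ : Unit => (0 : ℝ)) ∘ fun _ : Unit => ())) 1 ℂ =>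
    ((WSup.toPiL (pinW (0 : ℝ) ((fun _ : Unit => (0 : ℝ)) ∘ fun _ : Unit => ())) 1).symm
      ((fun _ : Unit → ℂ => (0 : Unit → ℂ))
        (WSup.toPiL (pinW (0 : ℝ) ((fun _ : Unit => (0 : ℝ)) ∘ fun _ : Unit => ())) 1 Y)) :
          WSup (pinW (0 : ℝ) ((fun _ : Unit => (0 : ℝ)) ∘ fun _ : Unit => ())) 1 ℂ)) (0 * 1) 1 :=
  prop4Hyp_pinned_of_entry_decay (S := Unit) (fun _ _ => 0) (fun _ => ()) (fun _ => ()) (fun _ => 0)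
    (δ := 0) le_rfl le_rfl zero_le_one (fun _ => le_rfl) (fun _ _ => by simp) (fun _ => by simp)
    (differentiableOn_const _) rfl
    (fun A _ c b => by
      have h : dker (fun _ : Unit → ℂ => (0 : Unit → ℂ)) A c b = 0 := by
        ext; simp [dker_apply]
      rw [h, norm_zero]; positivity)

end Toy

end Summit.QuantumFields.BalabanUV.T4Continuum.ShellMeasureGradientPinnedDecay

end
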